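import Summits.PneNP.PneNP.Theses.ArnoldMorseDeficit
import Literature.Computability.Complexity.TFNPProblems
import Literature.Computability.Complexity.TFNPLocalSearch
import Literature.Computability.Complexity.ClayProblem
import Literature.Computability.Complexity.ClayProblemProofs

/-!
# BC2 (c) in substance — every TFNP-hardness piece gives the summit `PneNP` on its own
# (strategist census evidence for stmt-PneNP-11725 `MorseDeficitHard`, route ArnoldMorseDeficit)

Mechanically the probe `EoplHard → PneNP` by `first | exact? | simpa | aesop` FAILS (bc/EoplHard_probe.lean),
but only because the routine membership lemma `TFNP.EndOfPotentialLine.rel ∈ Classes.P` ("checking an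
END-OF-POTENTIAL-LINE solution is polynomial time": evaluate three circuits, compare two numbers) is not yet
vendored (TFNPProblems.lean module doc: "NOT here (a stack-program exercise with `CircEval.evalFn_mem_FP`):
`rel ∈ P`").  Modulo that one hypothesis the implication is the ten lines of `tfnpHard_gives_summit` below, over
landed Literature theorems only (`SearchProblem.not_NP_subset_P_of_not_solvableInFP`, `P_bool_eq_holds`,
`NP_bool_eq_holds`) — and the SAME ten lines serve every hardness piece `¬ R.SolvableInFP` of every
polynomially balanced total search problem `R` with `rel ∈ P` (EOPL, ITER, LOCALOPT, SINK-OF-DAG, END-OF-LINE, …).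
So in any split `MorseDeficitHard ⟸ (R ≤ₘ MORSE-DEFICIT) ∧ (R ∉ FP)` the hardness piece is summit-or-harder:
the redirect moves the summit-strength from `MorseDeficitHard` to the piece, it does not remove it.
-/

open Literature.Computability.Complexity

/-- **Generic**: a total, balanced, `P`-checkable search problem that no `FP` function solves gives Cook's
`PneNP` (ten lines over landed theorems). -/
theorem tfnpHard_gives_summit {R : SearchProblem} (hrel : R.rel ∈ Classes.P) (hb : R.IsPolyBalanced)
    (ht : R.IsTotal) (hX : ¬ R.SolvableInFP) : PneNP := by
  by_contra hcon
  have hP : PNPWave0.P Bool = Classes.P := P_bool_eq_holds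
  have hN : PNPWave0.NP Bool = Nondeterministic.NP := NP_bool_eq_holds
  have hsub : Nondeterministic.NP ⊆ Classes.P := by
    intro L hL
    by_contra hLP
    exact hcon ⟨L, hN ▸ hL, hP ▸ hLP⟩
  exact SearchProblem.not_NP_subset_P_of_not_solvableInFP hrel hb ht hX hsub

/-- D1 (the filed EOPL split): `EoplHard → PneNP` modulo `EndOfPotentialLine.rel ∈ P`. -/
theorem eoplHard_gives_summit (hrel : TFNP.EndOfPotentialLine.rel ∈ Classes.P) :
    Summit.PneNP.PneNP.Theses.ArnoldMorseDeficit.EoplHard → PneNP :=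
  tfnpHard_gives_summit hrel TFNP.EndOfPotentialLine.isPolyBalanced TFNP.EndOfPotentialLine.isTotal

/-- D2 (the PLS split): `PlsHard := ¬ TFNP.Iter.SolvableInFP` gives `PneNP` modulo `Iter.rel ∈ P`. -/
theorem plsHard_gives_summit (hrel : TFNP.Iter.rel ∈ Classes.P) :
    ¬ TFNP.Iter.SolvableInFP → PneNP :=
  tfnpHard_gives_summit hrel TFNP.Iter.isPolyBalanced TFNP.Iter.isTotal

/-- D3 (the PPAD split): `PpadHard := ¬ TFNP.EndOfLine.SolvableInFP` gives `PneNP` modulo `EndOfLine.rel ∈ P`. -/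
theorem ppadHard_gives_summit (hrel : TFNP.EndOfLine.rel ∈ Classes.P) :
    ¬ TFNP.EndOfLine.SolvableInFP → PneNP :=
  tfnpHard_gives_summit hrel TFNP.EndOfLine.isPolyBalanced TFNP.EndOfLine.isTotal

/-- D5/D9/D10 shape (a "lift" or "bridge" co-piece is the crux again once the provable piece lands):
for any propositions, `W → ((W → X) ↔ X)`. -/
theorem lift_piece_is_crux_mod_theorem {W X : Prop} (hW : W) : (W → X) ↔ X :=
  ⟨fun h => h hW, fun hx _ => hx⟩

/-- D6 shape (case split on a dichotomy `A`): if `¬A → S` is a theorem (Meyer/Karp–Lipton–Kannan for circuit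
lower bounds `A`) and `X → S` (the route's Assembly), then the piece `A → X` already gives `S`. -/
theorem caseSplit_piece_gives_summit {A X S : Prop} (hnotA : ¬ A → S) (hXS : X → S) : (A → X) → S :=
  fun h => (Classical.em A).elim (fun hA => hXS (h hA)) hnotA
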